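import Mathlib.Algebra.Group.Basic
import Mathlib.Algebra.Polynomial.Coeff
import Mathlib.Algebra.Polynomial.Monic
import Mathlib.Algebra.Polynomial.Inductions
import Mathlib.Tactic.NormNum
import Mathlib.Tactic.LinearCombination
import Mathlib.Tactic.Linarith
import Mathlib.Tactic.Ring
import HarnessLib

/-!
# Corank one along the deficiency loci `R_q` — kernel skeleton (WEIL-2 gen 50, CORANK-G50, fact-free)

research route, not a corollary; conditional on HC_CM plus one named minimal statement.

Cell `pub-hodge-ring2-ab-*` (ALL ABELIAN VARIETIES), seat WEIL-2 gen 50, account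
`run/shared/lean/pub/pub-hodge-ring2/pub-hodge-ring2-ab-weil-2/CORANK-G50.md`.

Informal setting (FOLD-G49 §7, THEOREM D).  For the cyclic `d = 2` Galois–Prym data over a hyperelliptic base `Y`
of genus `q` (`y² = f(x)`, `deg f = 2q + 1`, `y₁ = ∞` a Weierstrass point, `y₄ = ι y₃`) the `K`-piece period map
`Φ` drops rank exactly on `R_q = {2D₀ ∼ B'}`.  CORANK-G50 proves:
* THEOREM N (normal form): on `R_q`, `f = a² + (x − x₂)u²` with `u` monic of degree exactly `q`, `deg a ≤ q`,
  `y₂ = (x₂, a(x₂))`, and `D₀ ∼ E⁻ − (q−2)∞`, `E⁻ = {u = 0, y = −a}` (the halves of a point are off the theta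
  divisor, as in Zarhin's description of division by two);
* THEOREM D⁺: with `s = (y − a)/u` the space `W₂ = L(2E⁻ + 2q∞)` has the basis
  `{x^j (j ≤ q), x^k s (k ≤ q−1), x^l s² (l ≤ q−1)}` and `V·V`, `V = L(E⁻ + q∞) = ⟨x^j (j ≤ ⌊q/2⌋), x^k s (k ≤ ⌊(q−1)/2⌋)⟩`,
  is the span of all basis elements but one, `s_* = x^q` (`q` odd) resp. `x^{q−1}s²` (`q` even): corank EXACTLY one at
  every member of `R_q`, every `q ≥ 1`;
* LEMMA C_q / T_q / T′_q: the conormal space of `R_q` is `d log(x − x₃) ⊗ H⁰(ω_Y)`; the kernel line `κ` of `dΦ` is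
  transversal to `R_q` at every member (its normal component is «evaluation at `y₁`»), and for `q ≥ 2` it always moves
  the modulus of `Y`.

This file holds the finite algebra: the two polynomial identities behind THEOREM N / D⁺ / T_q (the minimal relation
`u s² + 2a s = (x − x₂)u` of `s`, the norm `s·ῑs = −(x − x₂)`, and `2y(y − a) = u²(s² + x − x₂)`), the coefficient
extraction behind LEMMA T_q for odd `q`, the degree step of THEOREM N, and the dimension bookkeeping (basis counts,
products, splitting type, `deg N = −2`, the Thom–Boardman excess).  Mathlib only, 0 sorry, no `def`, no named fact;
`HC_CM` does not occur.
-/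

namespace Summit.HodgeConjecture.Ring2AbelianAll.PrymTorelliCorank

section identities

variable {R : Type*} [CommRing R]

/-- CORANK-G50 §1 (THEOREM N, the norm of `y + a`).  If `y² = a² + (x − x₂)u²` then
`(y + a)(y − a) = (x − x₂)u²`: the function `y + a` has norm `−(x − x₂)u²`, so its divisor is `2E⁻ + ῑy₂ − (2q+1)∞`
and `g₁ = (y + a)/(x − x₂)` realises `2E⁻ ∼ y₂ + (2q − 1)∞`, i.e. `2D₀ ∼ B'`.
research route, not a corollary; conditional on HC_CM plus one named minimal statement. -/
theorem norm_identity (x x₂ y a u : R) (hy : y ^ 2 = a ^ 2 + (x - x₂) * u ^ 2) :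
    (y + a) * (y - a) = (x - x₂) * u ^ 2 := by
  linear_combination hy

/-- CORANK-G50 §2 (THEOREM D⁺, the minimal relation of `s = (y − a)/u`).  In a domain, from `y² = a² + (x − x₂)u²`
and `u s = y − a` with `u ≠ 0`: `u s² + 2a s = (x − x₂) u`.  This is the one relation among `1, s, s²` over `k[x]`;
its coefficients `(u, 2a, −(x − x₂)u)` have degrees `(q, ≤ q, q + 1)`, which is why the `3q + 1` elements
`x^j, x^k s, x^l s²` (`j ≤ q`, `k, l ≤ q − 1`) are linearly independent.
research route, not a corollary; conditional on HC_CM plus one named minimal statement. -/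
theorem minimal_relation [NoZeroDivisors R] (x x₂ y a u s : R) (hu : u ≠ 0)
    (hy : y ^ 2 = a ^ 2 + (x - x₂) * u ^ 2) (hs : u * s = y - a) :
    u * s ^ 2 + 2 * a * s = (x - x₂) * u := by
  have h : u * (u * s ^ 2 + 2 * a * s - (x - x₂) * u) = 0 := by
    linear_combination hy + (u * s + y + a) * hs
  rcases mul_eq_zero.mp h with h0 | h0
  · exact absurd h0 hu
  · exact sub_eq_zero.mp h0

/-- CORANK-G50 §2 (the norm of `s`).  With `u s = y − a` and `u s' = −y − a` (`s' = ῑ^* s`):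
`u²·(s s') = −(x − x₂)·u²`, i.e. `s · ῑ^*s = −(x − x₂)` after cancelling `u²`; so `div s = ῑE⁻ + y₂ − E⁻ − ∞`.
research route, not a corollary; conditional on HC_CM plus one named minimal statement. -/
theorem norm_of_s (x x₂ y a u s s' : R) (hy : y ^ 2 = a ^ 2 + (x - x₂) * u ^ 2)
    (hs : u * s = y - a) (hs' : u * s' = -y - a) :
    u ^ 2 * (s * s') = -((x - x₂) * u ^ 2) := by
  linear_combination (-1 : R) * hy + (u * s') * hs + (y - a) * hs'

/-- CORANK-G50 §4 (LEMMA T_q, the key identity).  From `y² = a² + (x − x₂)u²` and `u s = y − a`: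
`2·y·(y − a) = u²·(s² + (x − x₂))`.  Dividing by `2u²`: the conormal covector `x^i y/(x − x₃)·ω₀²` divided by
`g = (y + a)/((x − x₂)(x − x₃))` is `x^i·y(y − a)/u² = ½·x^i·(s² + x − x₂)`, whose `s_*`-coordinate is `½·[i = q − 1]`.
research route, not a corollary; conditional on HC_CM plus one named minimal statement. -/
theorem two_y_mul (x x₂ y a u s : R) (hy : y ^ 2 = a ^ 2 + (x - x₂) * u ^ 2) (hs : u * s = y - a) :
    2 * y * (y - a) = u ^ 2 * (s ^ 2 + (x - x₂)) := by
  linear_combination hy - (u * s + y - a) * hs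

/-- CORANK-G50 §4 (LEMMA T_q, the quotient by `g`).  With `g = (y + a)/((x − x₂)(x − x₃))` and
`(y + a)(y − a) = (x − x₂)u²`: `[xⁱ y/(x − x₃)] / g = xⁱ y (x − x₂)/(y + a) = xⁱ y (y − a)/u²`.  Recorded in the
cross-multiplied form `(xⁱ y)·(x − x₂)(x − x₃)·u² = (xⁱ y (y − a))·(x − x₃)·(y + a)` modulo `hy`.
research route, not a corollary; conditional on HC_CM plus one named minimal statement. -/
theorem conormal_over_g (x x₂ x₃ y a u xi : R) (hy : y ^ 2 = a ^ 2 + (x - x₂) * u ^ 2) :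
    (xi * y) * ((x - x₂) * (x - x₃)) * u ^ 2 = (xi * y * (y - a)) * (x - x₃) * (y + a) := by
  linear_combination (-(xi * y * (x - x₃))) * hy

/-- CORANK-G50 §5 (LEMMA T′_q, the quotient `x^m/g`).  `x^m / g = x^m (x − x₂)(x − x₃)/(y + a) = x^m (x − x₃)(y − a)/u²
= x^m (x − x₃)·s/u`; cross-multiplied modulo `hy`: `x^m (x − x₂)(x − x₃)·u² = x^m (x − x₃)(y − a)·(y + a)`.
research route, not a corollary; conditional on HC_CM plus one named minimal statement. -/
theorem quadratic_over_g (x x₂ x₃ y a u xm : R) (hy : y ^ 2 = a ^ 2 + (x - x₂) * u ^ 2) :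
    xm * (x - x₂) * (x - x₃) * u ^ 2 = xm * (x - x₃) * (y - a) * (y + a) := by
  linear_combination (-(xm * (x - x₃))) * hy

/-- CORANK-G50 §1 (THEOREM N ⇔ Zarhin's square roots).  At a root `α` of `f = a² + (x − x₂)u²`:
`a(α)² = (x₂ − α)·u(α)²`, so `𝔯(α) := a(α)/u(α)` is a square root of `x₂ − α` (`u(α) ≠ 0`) — the datum by which
Zarhin parametrises the halves of the point `y₂ = (x₂, a(x₂))`.
research route, not a corollary; conditional on HC_CM plus one named minimal statement. -/
theorem zarhin_square_root (α x₂ aα uα : R) (hf : aα ^ 2 + (α - x₂) * uα ^ 2 = 0) :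
    aα ^ 2 = (x₂ - α) * uα ^ 2 := by
  linear_combination hf

end identities

section coefficient

open Polynomial

variable {R : Type*} [CommRing R]

/-- CORANK-G50 §4 (LEMMA T_q for odd `q`: the `s_* = x^q` coordinate).  If `b` has no `x^q`-coefficient
(`deg b ≤ q − 1`, `q = n + 1`), the coefficient of `x^q` in `b·(x − x₂)` is the coefficient of `x^{q−1}` in `b`:
so `Λ(½ b (s² + x − x₂)) = ½ b_{q−1}`, non-zero iff the differential `b(x)dx/y` does not vanish at `y₁ = ∞`.
research route, not a corollary; conditional on HC_CM plus one named minimal statement. -/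
theorem sstar_coefficient_odd (b : R[X]) (x₂ : R) (n : ℕ) (hb : b.coeff (n + 1) = 0) :
    (b * (X - C x₂)).coeff (n + 1) = b.coeff n := by
  rw [coeff_mul_X_sub_C, hb, zero_mul, sub_zero]

/-- CORANK-G50 §1 (THEOREM N (i), degree bookkeeping).  If `u` is monic of degree `q` and `deg a ≤ q` then
`f = (x − x₂)u² + a²` is monic of degree `2q + 1`: the normal form always produces an odd-degree model of genus `q`
(squarefreeness is the only condition), and conversely `deg(a² − f) ≤ 2q + 1` with leading coefficient `−1` pins
`a² − f = −(x − x₂)u_E²`.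
research route, not a corollary; conditional on HC_CM plus one named minimal statement. -/
theorem normal_form_monic [Nontrivial R] (u a : R[X]) (x₂ : R) (q : ℕ) (hu : u.Monic) (hdu : u.natDegree = q)
    (ha : a.natDegree ≤ q) :
    ((X - C x₂) * u ^ 2 + a ^ 2).Monic ∧ ((X - C x₂) * u ^ 2 + a ^ 2).natDegree = 2 * q + 1 := by
  have hm : ((X - C x₂) * u ^ 2).Monic := (monic_X_sub_C x₂).mul (hu.pow 2)
  have hd : ((X - C x₂) * u ^ 2).natDegree = 2 * q + 1 := by
    rw [(monic_X_sub_C x₂).natDegree_mul (hu.pow 2), natDegree_X_sub_C, hu.natDegree_pow, hdu]; ring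
  have ha2 : (a ^ 2).natDegree < ((X - C x₂) * u ^ 2).natDegree := by
    have h := natDegree_pow_le (p := a) (n := 2)
    rw [hd]; omega
  refine ⟨hm.add_of_left (degree_lt_degree ha2), ?_⟩
  rw [natDegree_add_eq_left_of_natDegree_lt ha2, hd]

end coefficient

section bookkeeping

/-- CORANK-G50 §1 (THEOREM N, the degree step).  In `L(π^*x₂ + (2r − 1)∞) = (x − x₂)⁻¹ L((2r+1)∞)` a term `xⁱ y`
needs `2i + (2q + 1) ≤ 2r + 1`; with `r ≤ q` this forces `i = 0` and `r = q`: the `y`-component of `g₁` exists only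
when the Mumford degree of `D₀ − 2y₁` is exactly `q`.
research route, not a corollary; conditional on HC_CM plus one named minimal statement. -/
theorem degree_step (q r i : ℕ) (hr : r ≤ q) (h : 2 * i + (2 * q + 1) ≤ 2 * r + 1) : i = 0 ∧ r = q := by
  omega

/-- CORANK-G50 §2 (THEOREM D⁺, the counts).  For `q ≥ 1`: `V = L(E⁻ + q∞)` has `(⌊q/2⌋ + 1) + (⌊(q−1)/2⌋ + 1) = q + 1`
elements `x^j, x^k s` (pole orders `2j ≤ q`, `2k + 1 ≤ q`); `W₂ = L(2E⁻ + 2q∞)` has `(q+1) + q + q = 3q + 1` elements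
(pole orders `2j ≤ 2q`, `2k + 1 ≤ 2q`, `2l + 2 ≤ 2q`); the products reach `x^m` for `m ≤ 2⌊q/2⌋`, `x^m s` for all
`m ≤ q − 1`, `x^m s²` for `m ≤ 2⌊(q−1)/2⌋`, i.e. `(2⌊q/2⌋ + 1) + q + (2⌊(q−1)/2⌋ + 1) = 3q` basis elements — all but one.
The splitting type of `π_*L` is `(⌊q/2⌋, ⌊(q−1)/2⌋)`, of sum `q − 1` (balanced).
research route, not a corollary; conditional on HC_CM plus one named minimal statement. -/
theorem basis_counts (q : ℕ) (hq : 1 ≤ q) :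
    (q / 2 + 1) + ((q - 1) / 2 + 1) = q + 1 ∧ (q + 1) + q + q = 3 * q + 1 ∧
    (2 * (q / 2) + 1) + q + (2 * ((q - 1) / 2) + 1) = 3 * q ∧ q / 2 + (q - 1) / 2 = q - 1 := by
  omega

/-- CORANK-G50 §2 (THEOREM D⁺, which element is missed).  `q` odd: the products miss `x^q` (`2⌊q/2⌋ = q − 1`) and reach
every `x^l s²` (`2⌊(q−1)/2⌋ = q − 1`); `q` even: they reach every `x^j` (`2⌊q/2⌋ = q`) and miss `x^{q−1}s²`
(`2⌊(q−1)/2⌋ = q − 2`).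
research route, not a corollary; conditional on HC_CM plus one named minimal statement. -/
theorem missed_element (q : ℕ) (hq : 1 ≤ q) :
    (q % 2 = 1 → 2 * (q / 2) = q - 1 ∧ 2 * ((q - 1) / 2) = q - 1) ∧
    (q % 2 = 0 → 2 * (q / 2) = q ∧ 2 * ((q - 1) / 2) = q - 2) := by
  omega

/-- CORANK-G50 §2 (THEOREM D⁺, basis-free proof).  `E = π_*L ≅ O(e₁) ⊕ O(e₂)` with `e₁ + e₂ = q − 1`, `e_i ≥ 0`;
`0 → N → Sym²E → π_*L² → 0` with `deg Sym²E = 3(q − 1)`, `deg π_*L² = 4q − (q + 1) = 3q − 1`, so `deg N = −2`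
and `coker(Sym² H⁰(L) → H⁰(L²)) ≅ H¹(ℙ¹, O(−2))` is a line; `h⁰(Sym²E) = (2e₁+1) + (e₁+e₂+1) + (2e₂+1) = 3q`.
For `L ≅ qG` instead the image is `H⁰(O(2q))`, of dimension `2q + 1`, corank `q`.
research route, not a corollary; conditional on HC_CM plus one named minimal statement. -/
theorem kernel_bundle_degree (q e₁ e₂ : ℤ) (he : e₁ + e₂ = q - 1) :
    3 * (q - 1) - (4 * q - (q + 1)) = -2 ∧ (2 * e₁ + 1) + (e₁ + e₂ + 1) + (2 * e₂ + 1) = 3 * q ∧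
    (3 * q + 1) - (2 * q + 1) = q := by
  refine ⟨by ring, by linarith, by ring⟩

/-- CORANK-G50 §6 (why the structure along `R_q` is not Thom–Boardman generic).  For a map from `3q + 1` to `(q+1)²`
dimensions the expected codimension of the corank-one locus is `(q+1)² − (3q+1) + 1 = q² − q + 1`, which exceeds
`q = codim R_q` for `q ≥ 2` (equality `1 = 1` at `q = 1`, the fold); the excess is forced by `V' ≅ V` on `R_q`.
The expected dimension of the double-point locus, `2(3q+1) − (q+1)²`, is `< dim R_q + 1 = 2q + 2` for `q ≥ 2`
(no partners are forced), and equals `4 = dim R + 1` at `q = 1`.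
research route, not a corollary; conditional on HC_CM plus one named minimal statement. -/
theorem thom_boardman_excess (q : ℤ) (hq : 2 ≤ q) :
    q < (q + 1) ^ 2 - (3 * q + 1) + 1 ∧ 2 * (3 * q + 1) - (q + 1) ^ 2 < 2 * q + 2 ∧
    ((1 + 1 : ℤ) ^ 2 - (3 * 1 + 1) + 1 = 1 ∧ 2 * (3 * 1 + 1) - (1 + 1 : ℤ) ^ 2 = 4) := by
  refine ⟨by nlinarith, by nlinarith, by norm_num, by norm_num⟩

/-- CORANK-G50 §3 (LEMMA C_q, the dimension of the conormal space).  The `ι`-anti-invariant quadratic differentials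
with poles bounded by `y₁ + y₃ + y₄` are `b(x)·dx²/((x − x₃)y)` with `deg b ≤ q − 1` (order at `∞`:
`2q − 3 − 2 deg b ≥ −1`): a space of dimension `q = codim R_q`; the invariant ones have dimension `3q − q = 2q = dim R̄'_q`
(`= (2q − 1) + 1`: hyperelliptic curves with a marked Weierstrass point and one free point).
research route, not a corollary; conditional on HC_CM plus one named minimal statement. -/
theorem conormal_count (q d : ℕ) (hq : 1 ≤ q) (hd : d ≤ q - 1) :
    (2 * q : ℤ) - 3 - 2 * d ≥ -1 ∧ 3 * q - q = 2 * q ∧ (2 * q - 1) + 1 = 2 * q := by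
  refine ⟨by omega, by omega, by omega⟩

end bookkeeping

section secondOrder

/-!
## Second order along `R_q` (CORANK-G50 §10, THEOREM S)

For a base-fixed first-order deformation `ξ` of a member `x ∈ R_q` (one branch point moving), the intrinsic second
derivative of the period map is `D²Φ_x(κ, ξ)(λ) = ((−1)^{q+1}/6)·⟨ν(ξ), ϖ(λ)⟩`, where `ν(ξ) ∈ T₀J(Y) = H¹(O_Y)` is the
derivative of `AJ(A − 3B')`, `⟨,⟩` is Serre duality and `ϖ : ker μ_x → H⁰(det π_*L) ≅ H⁰(ω_Y)` is the exterior product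
(`x^j ∧ x^k s ↦ x^{j+k} dx/y`, the rest to `0`).  The proof reduces to a Čech computation with the operators
`Q_n(P) = ⌊P/x^n⌋`; the lemmas below record the polynomial step `x·⌊P/x⌋ = P − P(0)`, the weights, the constant, and
the counts used in the corollaries (cusp along `κ`; image germ singular along `Φ(R_q)` for `q ≥ 2`; `Σ¹` reduced for `q = 2`).
-/

open Polynomial in
/-- CORANK-G50 §10.4 (the shift identity behind `x·Q_n(P) − Q_{n−1}(P) = −P_{n−1}`): for every polynomial `p`,
`X · ⌊p/X⌋ = p − p(0)`, with Mathlib's `divX` as `⌊·/X⌋`.  Iterating, `x Q_n(P) − Q_{n−1}(P)` is the constant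
`−[x^{n−1}]P`, which is why the symmetric (quadric) relations of `ker μ` pair to zero.
research route, not a corollary; conditional on HC_CM plus one named minimal statement. -/
theorem divX_shift {R : Type*} [CommRing R] (p : R[X]) : X * divX p = p - C (p.coeff 0) := by
  linear_combination divX_mul_X_add p

/-- CORANK-G50 §10.2 (the class of the universal principal part).  Moving the branch point `y_i` of exponent `e_i`
with unit speed, the sheet class moves by `(e_i/6)·v(y_i)` and the principal part `1/z_i − 2Σ c_j/z_j` has class
`(1 − e_i/3)·v(y_i) = −(e_i − 3)/3 · v(y_i) = −ν(ξ)/3`; the table for the exponents of both `μ₆` types: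
`e = 1, 2, 3, 4, 5 ↦ 2/3, 1/3, 0, −1/3, −2/3` (the exponent-3 point is tangent to `R_q`).
research route, not a corollary; conditional on HC_CM plus one named minimal statement. -/
theorem pp_class_weights (e : ℚ) :
    1 - 2 * (e / 6) = -(e - 3) / 3 ∧
    ((1 : ℚ) - 2 * (1 / 6) = 2 / 3 ∧ (1 : ℚ) - 2 * (2 / 6) = 1 / 3 ∧ (1 : ℚ) - 2 * (3 / 6) = 0 ∧
     (1 : ℚ) - 2 * (4 / 6) = -1 / 3 ∧ (1 : ℚ) - 2 * (5 / 6) = -2 / 3) := by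
  refine ⟨by ring, by norm_num⟩

/-- CORANK-G50 §10.4–10.5 (the constant).  The Čech computation gives `β_η(x^j ∧ x^k s) = σ_q·[η = η_{j+k+1}]` with
`σ_q = (−1)^q`, the Serre pairing has `⟨η_n, x^i dx/y⟩ = 2·[n = i+1]` (two points over `x = 0`), and `η(ξ) = −ν(ξ)/3`;
so `D²Φ(κ,ξ) = σ_q/2 · ⟨η(ξ), ϖ⟩ = −σ_q/6 · ⟨ν(ξ), ϖ⟩ = (−1)^{q+1}/6 · ⟨ν(ξ), ϖ⟩` — the value found by the geometric
engine (`1/6 ≡ 176`, `−1/6 ≡ 35 (mod 211)`; `1/6 ≡ 33 (mod 197)`).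
research route, not a corollary; conditional on HC_CM plus one named minimal statement. -/
theorem second_order_constant (σ : ℚ) :
    (σ / 2) * (-1 / 3) = -σ / 6 ∧ (6 : ℤ) * 176 % 211 = 1 ∧ (6 : ℤ) * 35 % 211 = 211 - 1 ∧ (6 : ℤ) * 33 % 197 = 1 := by
  refine ⟨by ring, by norm_num, by norm_num, by norm_num⟩

/-- CORANK-G50 §10.3 (`ϖ` is onto `H⁰(ω_Y)`): every degree `m ≤ q − 1` is `j + k` with `j ≤ ⌊q/2⌋`, `k ≤ ⌊(q−1)/2⌋`
(take `j = min(m, ⌊q/2⌋)`).  Hence the intrinsic derivative `N_x → (ker μ_x)^∨` of THEOREM S has rank equal to the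
rank of `ν` on the directions considered: `2` on the base-fixed normal plane for `q ≥ 2`, and `q` under CONJECTURE S.
research route, not a corollary; conditional on HC_CM plus one named minimal statement. -/
theorem varpi_surjective (q m : ℕ) (hq : 1 ≤ q) (hm : m ≤ q - 1) :
    ∃ j k : ℕ, j ≤ q / 2 ∧ k ≤ (q - 1) / 2 ∧ j + k = m :=
  ⟨min m (q / 2), m - min m (q / 2), Nat.min_le_right _ _, by omega, by omega⟩

/-- CORANK-G50 §10.4 (why the quadric relations pair to zero) and §10.6 (the base-fixed normal plane).  For `q ≥ 3`
the Čech representatives of the symmetric relations have degree `≤ ⌊q/2⌋ ≤ q − 2 < q − 1`, below the `s_*`-coordinate;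
for `q ≥ 2` the evaluations at `y₁` and `y₄` are independent on `H⁰(ω_Y)` (`h⁰(ω_Y(−y₁ − y₄)) = q − 2`), so the
second derivative has rank `≥ 2` on `N_x` and the image germ of the period map is singular along `Φ(R_q)`; for `q = 2`
the rank is `2 = q = codim R_2` (the degeneracy scheme is reduced).
research route, not a corollary; conditional on HC_CM plus one named minimal statement. -/
theorem second_order_counts (q : ℕ) :
    (3 ≤ q → q / 2 ≤ q - 2 ∧ q - 2 < q - 1) ∧ (2 ≤ q → (q - 2) + 2 = q ∧ 2 ≤ q) ∧ (q = 2 → min 2 q = q) := by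
  refine ⟨fun h => ⟨by omega, by omega⟩, fun h => ⟨by omega, h⟩, fun h => by subst h; rfl⟩

end secondOrder

section explicitKernel

/-- CORANK-G50 §10.12 (PROPOSITION K (ii), the velocity of the marked point).  Pairing the normalised kernel line `κ` with
`d log h ⊗ ω_{q−1}` gives `½` (LEMMA T_q); in the Kodaira–Spencer residue formula only the point-move term at `y₁ = ∞` survives,
with residue `Res_∞((x^{q−1}/((x − x₃)y))·4z⁻⁶ dz) = 4` and sign `−`; so `½ = −4·ż₁`, `ż₁ = −1/8` — the value `79 (mod 211)`,
`123 (mod 197)` seen at every member by the engine.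
research route, not a corollary; conditional on HC_CM plus one named minimal statement. -/
theorem marked_point_velocity (z : ℚ) (h : (1 : ℚ) / 2 = -4 * z) :
    z = -1 / 8 ∧ (8 : ℤ) * 79 % 211 = 211 - 1 ∧ (8 : ℤ) * 123 % 197 = 197 - 1 := by
  refine ⟨by linarith, by norm_num, by norm_num⟩

/-- CORANK-G50 §10.12 (PROPOSITION K (i),(iii), counts).  The `ι`-anti-invariant quadratic differentials `b·y·ω₀²` have
`deg b ≤ q − 3`, so `½ b (x−x₃)(s² + x − x₂)` has `x`-degree `≤ q − 1 < q` and `s²`-degree `≤ q − 2 < q − 1`: `κ` pairs to zero with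
them (it is tangent to the hyperelliptic locus).  The explicit deformations `(ḟ, ż₁, ẋ₂, ẋ₃, ẋ₄)` with `deg ḟ ≤ 2q` number `2q + 5`; modulo
translation and scaling, `2q + 3` — equal to `dim Hur = 3q + 1` iff `q = 2` (for `q = 1` the count `2q+3 = 5` exceeds `dim Hur = 4`: `ḟ` of degree `≤ 2` already carries a trivial direction).
research route, not a corollary; conditional on HC_CM plus one named minimal statement. -/
theorem explicit_kernel_counts (q : ℕ) (hq : 1 ≤ q) :
    (3 ≤ q → (q - 3) + 2 ≤ q - 1 ∧ (q - 3) + 1 < q - 1) ∧ (2 * q + 1) + 4 - 2 = 2 * q + 3 ∧ (2 * q + 3 = 3 * q + 1 ↔ q = 2) := by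
  refine ⟨fun h => ⟨by omega, by omega⟩, by omega, by omega⟩

end explicitKernel

end Summit.HodgeConjecture.Ring2AbelianAll.PrymTorelliCorank
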